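import Summits.QuantumFields.YangMills.Theorems.LuscherReductionTwistedTraceScalingGaugeGroupGnChart
import Mathlib.Analysis.SpecialFunctions.Gaussian.GaussianIntegral
import Mathlib.MeasureTheory.Integral.Pi
import HarnessLib

/-!
# The GAUSSIAN SANDWICH for integrals over `SU(2)^ι` in the gnomonic chart: `(2π²)^{-|ι|}·∫ e^{−2‖w‖²} G ≤ ∫ g dHaar^{⊗ι} ≤ (2π²)^{-|ι|}·∫ G`
# (the Laplace entrance for the Faddeev–Popov weight and the gauge-averaged kernel; lane A of S-BASE, crux `TwistedTraceScaling` stmt-QuantumFields-20203, C4 INNER;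
# design note `pub/ym-fleet/ym-luscher-20007-p1/COARSE-DESIGN.md` §23.5 (c))

For a non-negative bounded measurable `g` on `SU(2)^ι` vanishing as soon as one factor lies in the closed lower hemisphere, `…GaugeGroupGnChart` gives
`∫ g dHaar^{⊗ι} = ∫ ρ(w) G(w) dw`, `G(w) = g(i ↦ P(1, w_i))`, `ρ(w) = ∏_i (2π²)⁻¹(1+|w_i|²)⁻²`.  Since `1 + x ≤ e^x`:
* `gnoWeight_ge_exp`: `(2π²)⁻¹ e^{−2|v|²} ≤ w(v) ≤ (2π²)⁻¹`; `piGnDensityReal_ge_exp`: `(2π²)^{-|ι|} e^{−2Σ_i|w_i|²} ≤ ρ(w) ≤ (2π²)^{-|ι|}`;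
* ★★ `integral_pi_haar_le_flat` / `integral_pi_haar_ge_gaussian`: the two-sided SANDWICH above (upper bound for `G` integrable on `ℝ^{3|ι|}`; the lower bound's Gaussian
  factor makes its integrand integrable for every bounded `G` — `integrable_gaussianEnvelope_mul`).
So a Gaussian integrand `G = e^{−β Q(w)}` is squeezed between the flat Gaussian integrals of `βQ` and `βQ + 2‖·‖²`, whose ratio is `det(I + 2(βQ)⁻¹)^{1/2} = 1 + O(|ι|‖Q⁻¹‖/β)`:
Laplace asymptotics on the gauge group to relative precision `O(1/β)` with NO Taylor expansion of the Haar density (tree Gaussian calculus: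
`Literature…GaussianQuadraticMGF.integral_exp_neg_half_quadForm_add_dotProduct` after currying `ι → ℝ³ ≃ (ι × Fin 3) → ℝ`).
HONEST FRAMING: elementary measure bookkeeping for a stub of a child of the CONDITIONAL reduction route R2b1; no kernel estimate; C4 OPEN; not a gap, not Clay.
-/

set_option autoImplicit false

noncomputable section

open MeasureTheory Filter Topology Real
open scoped ENNReal BigOperators
open Literature.MathematicalPhysics.QuantumFieldTheory
open Literature.MathematicalPhysics.QuantumLattice
open Literature.MathematicalPhysics.QuantumFieldTheory.Balaban1983to89.T4CubeChartGnomonic (gnoPoint gnoWeight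
  gnoWeight_pos gnoWeight_le measurable_gnoWeight continuous_gnoPoint)

namespace Summit.QuantumFields.YangMills.Theorems.FemtoTransferGap.TwoLattice.GnChart

open Summit.QuantumFields.YangMills.Theorems.FemtoTransferGap

variable (ι : Type*) [Fintype ι]

/-! ## §1 Two-sided bounds on the gnomonic Haar density -/

/-- `(1 + x)⁻² ≥ e^{−2x}` for `x ≥ 0`. [folklore] -/
theorem inv_one_add_sq_ge_exp {x : ℝ} (hx : 0 ≤ x) : Real.exp (-(2 * x)) ≤ ((1 + x)⁻¹) ^ 2 := by
  have h1 : 1 + x ≤ Real.exp x := by have := Real.add_one_le_exp x; linarith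
  have h0 : 0 < 1 + x := by linarith
  have h2 : Real.exp (-x) ≤ (1 + x)⁻¹ := by
    rw [Real.exp_neg]; exact inv_anti₀ h0 h1
  rw [show -(2 * x) = -x + -x by ring, Real.exp_add, ← sq]
  exact pow_le_pow_left₀ (Real.exp_pos _).le h2 2

/-- ★ **Gaussian lower envelope of the gnomonic weight**: `(2π²)⁻¹ e^{−2|v|²} ≤ w(v)`. [folklore] -/
theorem gnoWeight_ge_exp (v : Fin 3 → ℝ) : (2 * π ^ 2)⁻¹ * Real.exp (-(2 * ∑ a, v a ^ 2)) ≤ gnoWeight v := by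
  unfold gnoWeight
  exact mul_le_mul_of_nonneg_left (inv_one_add_sq_ge_exp (Finset.sum_nonneg fun a _ => sq_nonneg (v a))) (by positivity)

/-- ★ **Gaussian lower envelope of the product density**: `(2π²)^{-|ι|} e^{−2Σ_i|w_i|²} ≤ ρ(w)`. [folklore] -/
theorem piGnDensityReal_ge_exp (w : ι → Fin 3 → ℝ) :
    ((2 * π ^ 2)⁻¹) ^ Fintype.card ι * Real.exp (-(2 * ∑ i, ∑ a, w i a ^ 2)) ≤ piGnDensityReal ι w := by
  unfold piGnDensityReal
  rw [Finset.mul_sum, neg_eq_neg_one_mul, Finset.mul_sum, Real.exp_sum, ← Finset.card_univ, ← Finset.prod_const, ← Finset.prod_mul_distrib]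
  refine Finset.prod_le_prod (fun i _ => by positivity) fun i _ => ?_
  have := gnoWeight_ge_exp (w i)
  rwa [show -1 * (2 * ∑ a, w i a ^ 2) = -(2 * ∑ a, w i a ^ 2) by ring]

/-! ## §2 The Gaussian envelope is integrable -/

/-- The flat Gaussian `e^{−2Σ_{i,a} w_{ia}²}` is integrable on `ι → ℝ³`. [folklore] -/
theorem integrable_gaussianEnvelope : Integrable (fun w : ι → Fin 3 → ℝ => Real.exp (-(2 * ∑ i, ∑ a, w i a ^ 2))) := by
  have h1 : ∀ _i : ι, Integrable (fun v : Fin 3 → ℝ => Real.exp (-(2 * ∑ a, v a ^ 2))) := fun _ => by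
    have h2 : ∀ _a : Fin 3, Integrable (fun x : ℝ => Real.exp (-2 * x ^ 2)) := fun _ => integrable_exp_neg_mul_sq (by norm_num)
    have h3 := Integrable.fintype_prod (μ := fun _ : Fin 3 => (volume : Measure ℝ)) h2
    refine (h3.congr (ae_of_all _ fun v => ?_))
    show ∏ a, Real.exp (-2 * v a ^ 2) = Real.exp (-(2 * ∑ a, v a ^ 2))
    rw [← Real.exp_sum, Finset.mul_sum, ← Finset.sum_neg_distrib]
    exact congrArg Real.exp (Finset.sum_congr rfl fun a _ => by ring)
  have h4 := Integrable.fintype_prod (μ := fun _ : ι => (volume : Measure (Fin 3 → ℝ))) h1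
  refine h4.congr (ae_of_all _ fun w => ?_)
  show ∏ i, Real.exp (-(2 * ∑ a, w i a ^ 2)) = Real.exp (-(2 * ∑ i, ∑ a, w i a ^ 2))
  rw [← Real.exp_sum, Finset.mul_sum, ← Finset.sum_neg_distrib]

/-- The Gaussian envelope times a bounded measurable function is integrable. [folklore] -/
theorem integrable_gaussianEnvelope_mul {G : (ι → Fin 3 → ℝ) → ℝ} (hG : Measurable G) {C : ℝ} (hC : ∀ w, |G w| ≤ C) :
    Integrable (fun w : ι → Fin 3 → ℝ => G w * Real.exp (-(2 * ∑ i, ∑ a, w i a ^ 2))) :=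
  (integrable_gaussianEnvelope ι).bdd_mul hG.aestronglyMeasurable (ae_of_all _ fun w => by rw [Real.norm_eq_abs]; exact hC w)

/-- The gnomonic weight is integrable on `ℝ³` (its integral is the Haar mass of a hemisphere). [folklore] -/
theorem integrable_gnoWeight : Integrable (gnoWeight : (Fin 3 → ℝ) → ℝ) := by
  have hfin : ∫⁻ v, ENNReal.ofReal (gnoWeight v) ∂(volume : Measure (Fin 3 → ℝ)) < ⊤ := by
    have h := (isFiniteMeasure_gnoDensityMeasure).measure_univ_lt_top
    rwa [gnoDensityMeasure, withDensity_apply _ MeasurableSet.univ, Measure.restrict_univ] at h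
  refine ⟨measurable_gnoWeight.aestronglyMeasurable, ?_⟩
  rw [hasFiniteIntegral_iff_norm]
  refine lt_of_le_of_lt (le_of_eq ?_) hfin
  refine lintegral_congr fun v => ?_
  rw [Real.norm_eq_abs, abs_of_pos (gnoWeight_pos v)]

/-- The product density is integrable on `ι → ℝ³`. [folklore] -/
theorem integrable_piGnDensityReal : Integrable (piGnDensityReal ι) := by
  have h := Integrable.fintype_prod (μ := fun _ : ι => (volume : Measure (Fin 3 → ℝ))) fun _ : ι => integrable_gnoWeight
  exact h.congr (ae_of_all _ fun w => rfl)

/-- The product density times a bounded measurable function is integrable. [folklore] -/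
theorem integrable_piGnDensityReal_mul {G : (ι → Fin 3 → ℝ) → ℝ} (hG : Measurable G) {C : ℝ} (hC : ∀ w, |G w| ≤ C) :
    Integrable (fun w : ι → Fin 3 → ℝ => G w * piGnDensityReal ι w) :=
  (integrable_piGnDensityReal ι).bdd_mul hG.aestronglyMeasurable (ae_of_all _ fun w => by rw [Real.norm_eq_abs]; exact hC w)

/-! ## §3 ★★ The sandwich -/

omit [Fintype ι] in
/-- The chart pull-back `G(w) = g(i ↦ P(1, w_i))` of a measurable `g` is measurable. [folklore] -/
theorem measurable_comp_vacuumChart {g : (ι → SU2) → ℝ} (hg : Measurable g) :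
    Measurable fun w : ι → Fin 3 → ℝ => g (piPatternChart ι (fun _ => false) w) :=
  hg.comp (measurable_piPatternChart ι _)

/-- ★★ **UPPER SANDWICH**: for `g ≥ 0` bounded measurable on `SU(2)^ι`, vanishing as soon as a factor lies in the closed lower hemisphere, with chart pull-back `G`
integrable on `ℝ^{3|ι|}`: `∫ g dHaar^{⊗ι} ≤ (2π²)^{-|ι|} · ∫ G`. [folklore] -/
theorem integral_pi_haar_le_flat [DecidableEq ι] {g : (ι → SU2) → ℝ} (hg : Measurable g) (hb : ∃ C : ℝ, ∀ U, |g U| ≤ C) (hpos : ∀ U, 0 ≤ g U)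
    (h0 : ∀ V : ι → SU2, (∃ i, scalarPart (V i) ≤ 0) → g V = 0)
    (hint : Integrable fun w : ι → Fin 3 → ℝ => g (piPatternChart ι (fun _ => false) w)) :
    ∫ U, g U ∂(Measure.pi fun _ : ι => haarProbability SU2) ≤
      ((2 * π ^ 2)⁻¹) ^ Fintype.card ι * ∫ w, g (piPatternChart ι (fun _ => false) w) ∂volume := by
  obtain ⟨C, hC⟩ := hb
  rw [integral_pi_haar_eq_vacuumChart ι hg ⟨C, hC⟩ h0, ← integral_const_mul]
  have hρG : Integrable fun w : ι → Fin 3 → ℝ => piGnDensityReal ι w * g (piPatternChart ι (fun _ => false) w) := by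
    have := integrable_piGnDensityReal_mul ι (measurable_comp_vacuumChart ι hg) (C := C) fun w => hC _
    exact this.congr (ae_of_all _ fun w => mul_comm _ _)
  refine integral_mono hρG (hint.const_mul _) fun w => ?_
  exact mul_le_mul_of_nonneg_right (piGnDensityReal_pos_le ι w).2 (hpos _)

/-- ★★ **LOWER SANDWICH**: for `g ≥ 0` bounded measurable on `SU(2)^ι`, vanishing as soon as a factor lies in the closed lower hemisphere:
`(2π²)^{-|ι|} · ∫ G(w) e^{−2Σ_{i,a} w_{ia}²} dw ≤ ∫ g dHaar^{⊗ι}`. [folklore] -/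
theorem integral_pi_haar_ge_gaussian [DecidableEq ι] {g : (ι → SU2) → ℝ} (hg : Measurable g) (hb : ∃ C : ℝ, ∀ U, |g U| ≤ C) (hpos : ∀ U, 0 ≤ g U)
    (h0 : ∀ V : ι → SU2, (∃ i, scalarPart (V i) ≤ 0) → g V = 0) :
    ((2 * π ^ 2)⁻¹) ^ Fintype.card ι * ∫ w, g (piPatternChart ι (fun _ => false) w) * Real.exp (-(2 * ∑ i, ∑ a, w i a ^ 2)) ∂volume ≤
      ∫ U, g U ∂(Measure.pi fun _ : ι => haarProbability SU2) := by
  obtain ⟨C, hC⟩ := hb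
  rw [integral_pi_haar_eq_vacuumChart ι hg ⟨C, hC⟩ h0, ← integral_const_mul]
  have hρG : Integrable fun w : ι → Fin 3 → ℝ => piGnDensityReal ι w * g (piPatternChart ι (fun _ => false) w) := by
    have := integrable_piGnDensityReal_mul ι (measurable_comp_vacuumChart ι hg) (C := C) fun w => hC _
    exact this.congr (ae_of_all _ fun w => mul_comm _ _)
  have henv := (integrable_gaussianEnvelope_mul ι (measurable_comp_vacuumChart ι hg) (C := C) fun w => hC _).const_mul
    (((2 * π ^ 2)⁻¹) ^ Fintype.card ι)
  refine integral_mono henv hρG fun w => ?_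
  show ((2 * π ^ 2)⁻¹) ^ Fintype.card ι * (g (piPatternChart ι (fun _ => false) w) * Real.exp (-(2 * ∑ i, ∑ a, w i a ^ 2))) ≤
    piGnDensityReal ι w * g (piPatternChart ι (fun _ => false) w)
  have h1 := piGnDensityReal_ge_exp ι w
  have h2 := hpos (piPatternChart ι (fun _ => false) w)
  nlinarith

/-- ★★ The sandwich for the gauge group of the torus (instance `ι = Site 3 L`). [folklore] -/
theorem integral_gaugeMeasure_sandwich (L : ℕ) [NeZero L] {g : (Site 3 L → SU2) → ℝ} (hg : Measurable g) (hb : ∃ C : ℝ, ∀ h, |g h| ≤ C)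
    (hpos : ∀ h, 0 ≤ g h) (h0 : ∀ h : Site 3 L → SU2, (∃ x, scalarPart (h x) ≤ 0) → g h = 0)
    (hint : Integrable fun w : Site 3 L → Fin 3 → ℝ => g (piPatternChart (Site 3 L) (fun _ => false) w)) :
    ((2 * π ^ 2)⁻¹) ^ Fintype.card (Site 3 L) *
        ∫ w, g (piPatternChart (Site 3 L) (fun _ => false) w) * Real.exp (-(2 * ∑ x, ∑ a, w x a ^ 2)) ∂volume ≤
      ∫ h, g h ∂(TwoLattice.Avg.gaugeMeasure L) ∧
    ∫ h, g h ∂(TwoLattice.Avg.gaugeMeasure L) ≤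
      ((2 * π ^ 2)⁻¹) ^ Fintype.card (Site 3 L) * ∫ w, g (piPatternChart (Site 3 L) (fun _ => false) w) ∂volume :=
  ⟨integral_pi_haar_ge_gaussian (Site 3 L) hg hb hpos h0, integral_pi_haar_le_flat (Site 3 L) hg hb hpos h0 hint⟩

end Summit.QuantumFields.YangMills.Theorems.FemtoTransferGap.TwoLattice.GnChart

end
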